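import Mathlib
import Literature.AlgebraicGeometry.Resolution.LocalBlowup
import HarnessLib

/-!
# Crux `DescentPerfectToAll` (stmt-ResolutionOfSingularities-0549) — NEGATION lens 6, generation 5 (res-B-lens-6 g5, 2026-08-29)
# Typed record of the g5 negation audit of the re-typed (β) family («clean local uniformization» currency).

bears_on: LADDER-RESOLUTION:B · [OURS · CANDIDATE] counted 0 · nothing here proves resolution in characteristic `p`
(resolution in char `p` is NOT proved; rung B = `PerfectRes_p → ResolutionInChar p` stays open) · Hironaka 2017 is never cited as fact.

This file is a WORKFILE (not a line: it does not conclude the crux).  It records, kernel-checked where cheap: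

* §1 `δ`-class lemmas (proved, no `sorry`): the form-3 test «`∃ c, s - c^p ∈ 𝔪 ∖ 𝔪²`» of the clean forms
  (`ViaCpFrame.CleanLUAtDim`, third disjunct; `RadicialJung.CleanModels` form 3) reduces to ONE computation: for any single `c₀`
  with `s - c₀^p ∈ 𝔪`, form 3 holds iff `s - c₀^p ∉ 𝔪²` (`form3_iff_of_mem`).  Reason: `(s - c'^p) - (s - c^p) = (c - c')^p ∈ 𝔪^p ⊆ 𝔪²`
  and `p`-th roots are unique modulo a prime.  This is the «`δ(s) := [s - c^p] ∈ 𝔪/𝔪²` is lift-independent» step used throughout the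
  memo `NEGATION-lens6-g5.md` (it is the pre-image of `ds ⊗ 1` under `𝔪/𝔪² → Ω ⊗ κ`, Matsumura Thm 25.2, but that identification is not
  needed here).
* §2 the clean-LU family with the GROUND FIELD FIXED (`CleanLUAtDimOver p k n`; for every prime `p` and every `k` of characteristic `p`,
  `ViaCpFrame.CleanLUAtDim n` is `∀ p prime k, CleanLUAtDimOver p k n` and `ViaCpFrame.CleanLUAtDimImperfectAt p n` is
  `p prime → ∀ k, ¬ PerfectField k → CleanLUAtDimOver p k n` — same binder order and VERBATIM conclusion; not imported here because crux
  workfiles are not importable modules on the farm), and the typed TRANSFER-DOWN statement `CleanLUTransferDown p n`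
  («clean LU at local dimension `n` over a ground field `k₀` ⇒ the same over every `k` essentially of finite type over `k₀`»), whose
  routine proof is written out in its docstring (same fraction field, same valuation ring, same local ring at the centre; only the
  book-keeping field changes).  Consequence recorded in the memo: the finitely-generated-ground-field part of the hardest local stub S2′
  (`stub_cleanLUImperfectDimGEFour`) is LITERALLY perfect-ground-field clean LU at non-closed centres of the same local dimension, i.e.
  (via composite valuations + generisation of `P_clean`, tree p659805/p660356) Giraud-type clean LU over PERFECT fields in ambient
  dimension `n + trdeg k`; only the NON-finitely-generated imperfect `k` are rung-B-proper.  The cheapest honest probe of the `dim 4`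
  perfect frontier is therefore 2-dimensional: `SurfaceProbeFpST p` = clean LU for surfaces over `𝔽_p(s,t)` (typed below).
* §3 (docstring only) the specimens computed in the memo: (a) `W₅ = V(z⁵ - s - z·x²y) ⊂ 𝔸³_{𝔽₅(s)}` (regular, non-smooth) with the
  golden monomial valuation — the CONSTANT radicand `s` is form-1 clean at every model point along the valuation and never form-2/3
  clean (the F-110 value-character obstruction of g3/g4 transplanted to a constant: every regular f.g. model along `v` is wounded by
  `⊗ k(s^{1/5})`; consistent with Disproof §3 and with `CleanLUAtDim 2`, which allows form 1); (b) `k = 𝔽_p(s)`, `W = 𝔸²`,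
  `P = (x^p - s, y)`, `G = x·(x^p - s)^p + y^{p+1}`: NOT loosely clean at `P` (saturated `dG` has order `p ≥ 2`), cleaned by ONE
  point blow-up (forms 2/3 on the `y = u·y₁` chart, form 3 on the other) — no counterexample to `CleanLUAtDim 2`.

Nothing in this file is served to provers; nothing is claimed beyond the checked lemmas of §1.
-/

noncomputable section

open Literature.AlgebraicGeometry.Resolution

namespace Summit.ResolutionOfSingularities.ResolutionOfSingularities.Cruxes.DescentPerfectToAll.NegationLens6g5

/-! ## §1 The `δ`-class of a residual `p`-th power is lift-independent (proved) -/

section DeltaClass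

variable {R : Type*} [CommRing R] (p : ℕ) [Fact p.Prime] [CharP R p]

/-- If `c - c' ∈ I` then `(s - c'^p) - (s - c^p) = (c - c')^p ∈ I^p ⊆ I²` (`p ≥ 2`).  [folklore] -/
theorem sub_pow_sub_sub_pow_mem_sq (I : Ideal R) (s : R) {c c' : R} (h : c - c' ∈ I) :
    (s - c' ^ p) - (s - c ^ p) ∈ I ^ 2 := by
  have hp : 2 ≤ p := (Fact.out : p.Prime).two_le
  have e : (s - c' ^ p) - (s - c ^ p) = (c - c') ^ p := by
    rw [sub_pow_char]; ring
  rw [e]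
  exact Ideal.pow_le_pow_right hp (Ideal.pow_mem_pow h p)

/-- `p`-th roots are unique modulo a prime ideal: `s ≡ c^p ≡ c'^p (mod P)` forces `c ≡ c' (mod P)`.  [folklore] -/
theorem sub_mem_of_sub_pow_mem (P : Ideal R) [hP : P.IsPrime] {s c c' : R}
    (hc : s - c ^ p ∈ P) (hc' : s - c' ^ p ∈ P) : c - c' ∈ P := by
  have h1 : (c - c') ^ p ∈ P := by
    have e : (c - c') ^ p = (s - c' ^ p) - (s - c ^ p) := by
      rw [sub_pow_char]; ring
    rw [e]
    exact P.sub_mem hc' hc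
  exact hP.mem_of_pow_mem p h1

/-- **Form-3 test by a single residual root.**  If `s - c₀^p ∈ P` (prime `P`, e.g. the maximal ideal of a local ring of
characteristic `p`), then «some `s - c^p` lies in `P ∖ P²`» iff `s - c₀^p ∉ P²`: the class `δ(s) = [s - c^p] ∈ P/P²` does not
depend on the root `c` chosen.  Used in the memo to decide form 3 at every specimen point by one expansion.  [folklore] -/
theorem form3_iff_of_mem (P : Ideal R) [P.IsPrime] {s c₀ : R} (h₀ : s - c₀ ^ p ∈ P) :
    (∃ c : R, s - c ^ p ∈ P ∧ s - c ^ p ∉ P ^ 2) ↔ s - c₀ ^ p ∉ P ^ 2 := by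
  constructor
  · rintro ⟨c, hc, hc2⟩ h2
    apply hc2
    have hcc : c₀ - c ∈ P := sub_mem_of_sub_pow_mem p P h₀ hc
    have hsq : (s - c ^ p) - (s - c₀ ^ p) ∈ P ^ 2 := sub_pow_sub_sub_pow_mem_sq p P s hcc
    have e : s - c ^ p = ((s - c ^ p) - (s - c₀ ^ p)) + (s - c₀ ^ p) := by ring
    rw [e]
    exact (P ^ 2).add_mem hsq h2
  · intro h
    exact ⟨c₀, h₀, h⟩

/-- The negative reading used on the specimens: if `s - c₀^p ∈ P²` for ONE root `c₀` modulo `P`, then NO representative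
`s - c^p` is a regular-parameter-type element (`∈ P ∖ P²`).  [folklore] -/
theorem no_form3_of_mem_sq (P : Ideal R) [P.IsPrime] {s c₀ : R} (h₀ : s - c₀ ^ p ∈ P ^ 2) (c : R)
    (hc : s - c ^ p ∈ P) : s - c ^ p ∈ P ^ 2 := by
  have h₀' : s - c₀ ^ p ∈ P := Ideal.pow_le_self two_ne_zero h₀
  by_contra hc2
  exact ((form3_iff_of_mem p P h₀').mp ⟨c, hc, hc2⟩) h₀

end DeltaClass

/-! ## §2 Clean LU with a fixed ground field; the transfer-down statement; the two-dimensional probe -/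

/-- **The conclusion of `ViaCpFrame.CleanLUAtDim` at the data `(p, k, K, O, A, g₀)`, VERBATIM**: a finitely generated
`A ⊆ A' ⊆ O`, regular at the centre of `O`, carrying a NON-TRIVIAL representative `∑ c_j^p g₀^j` of the `K^p`-line of `g₀` in one of
the three loose-clean forms (form 1: unit × monomial `∏ t_i^{a_i}`, `m > 0`, `p ∤ a_i`, in a regular system of parameters; form 2: a
unit that is not a `p`-th power residually; form 3: `s` with some `s - c'^p ∈ 𝔪 ∖ 𝔪²`).  [folklore] -/
def CleanConclusion (p : ℕ) (k K : Type) [Field k] [Field K] [Algebra k K] (O : ValuationSubring K)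
    (A : Subalgebra k K) (g₀ : K) : Prop :=
  ∃ (A' : Subalgebra k K), A'.toSubring ≤ O.toSubring ∧ A ≤ A' ∧ A'.FG ∧
    ∃ (_ : IsRegularLocalRing (locAtCentre A'.toSubring O)) (c : Fin p → K),
      (∃ j : Fin p, (j : ℕ) ≠ 0 ∧ c j ≠ 0) ∧
      ((∃ (d m : ℕ) (hmd : m ≤ d) (t : Fin d → ↥(locAtCentre A'.toSubring O)) (a : Fin m → ℕ)
          (u : ↥(locAtCentre A'.toSubring O)), IsUnit u ∧
          Ideal.span (Set.range t) = IsLocalRing.maximalIdeal ↥(locAtCentre A'.toSubring O) ∧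
          ringKrullDim ↥(locAtCentre A'.toSubring O) = (d : WithBot ℕ∞) ∧ 0 < m ∧ (∀ i, ¬ p ∣ a i) ∧
          (∑ j : Fin p, c j ^ p * g₀ ^ (j : ℕ)) =
            (u : K) * ∏ i : Fin m, ((t (Fin.castLE hmd i) : ↥(locAtCentre A'.toSubring O)) : K) ^ (a i)) ∨
        (∃ u : ↥(locAtCentre A'.toSubring O), IsUnit u ∧ (∑ j : Fin p, c j ^ p * g₀ ^ (j : ℕ)) = (u : K) ∧
          ∀ c' : ↥(locAtCentre A'.toSubring O), u - c' ^ p ∉ IsLocalRing.maximalIdeal ↥(locAtCentre A'.toSubring O)) ∨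
        (∃ s c' : ↥(locAtCentre A'.toSubring O), (∑ j : Fin p, c j ^ p * g₀ ^ (j : ℕ)) = (s : K) ∧
          s - c' ^ p ∈ IsLocalRing.maximalIdeal ↥(locAtCentre A'.toSubring O) ∧
          s - c' ^ p ∉ IsLocalRing.maximalIdeal ↥(locAtCentre A'.toSubring O) ^ 2))

/-- **Clean LU at centres of local dimension `n`, ground field FIXED to `k`** (`char k = p`).  With this notation
`ViaCpFrame.CleanLUAtDim n = ∀ p, p.Prime → ∀ k [Field k] [CharP k p], CleanLUAtDimOver p k n` and
`ViaCpFrame.CleanLUAtDimImperfectAt p n = (p.Prime → ∀ k [Field k] [CharP k p], ¬ PerfectField k → CleanLUAtDimOver p k n)`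
(binder-for-binder; S2′ = `stub_cleanLUImperfectDimGEFour` is the latter for `n ≥ 4` under `PerfectResAt p`).  NOTE the two typing facts the audit
relies on: (i) `¬ PerfectField k` constrains the GROUND field, not the residue field of the centre; (ii) `n` is the Krull dimension of
the LOCAL ring at the centre (`locAtCentre A O`), so centres of every height of every model are in scope.  [folklore] -/
def CleanLUAtDimOver (p : ℕ) (k : Type) [Field k] (n : ℕ) : Prop :=
  ∀ (K : Type) [Field K] [Algebra k K] (O : ValuationSubring K) (A : Subalgebra k K),
    A.toSubring ≤ O.toSubring → A.FG → IsFractionRing A K →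
    IsRegularLocalRing (locAtCentre A.toSubring O) →
    ringKrullDim (locAtCentre A.toSubring O) = (n : WithBot ℕ∞) →
    ∀ g₀ : K, (∀ c : K, c ^ p ≠ g₀) → CleanConclusion p k K O A g₀

/-- **Transfer-down along an essentially-finite-type extension of the GROUND field** (typed statement; proof routine, written here,
not kernel-checked): if clean LU at local dimension `n` holds with ground field `k₀`, it holds with ground field `k` for every field
`k` essentially of finite type over `k₀` (= finitely generated as a field, `IntermediateField.fg_top_iff`).
PROOF.  Let `(K ⊇ k, O, A, g₀)` be a `k`-instance; `k = Frac k₀[θ₁,…,θ_e]`.  Write `A = k[a₁,…,a_m]` and put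
`A₀ := k₀[θ₁,…,θ_e,a₁,…,a_m] ⊆ A` (a finitely generated `k₀`-subalgebra of `K`, `K` a `k₀`-algebra through `k`).  Then
`A₀ ⊆ O`, `Frac A₀ = K` (it contains generators of `k` and of `A`), and `S := k₀[θ] ∖ {0} ⊆ k^× ⊆ O^×` consists of units of `O`, so
`S ∩ (𝔪_O ∩ A₀) = ∅` and `locAtCentre A₀ O = locAtCentre A O` as subrings of `K` (every `y/z`, `y,z ∈ A = S⁻¹A₀`, `ν(z)=0`, is
`y₀/z₀` with `y₀, z₀ ∈ A₀`, `ν(z₀) = 0`, after clearing an `S`-denominator, which is a unit of `O`).  Hence the `k₀`-instance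
`(K, O, A₀, g₀)` satisfies the hypotheses (same regular local ring, same dimension `n`, same `g₀`); `CleanLUAtDimOver p k₀ n` returns
`A₀' ⊇ A₀`, finitely generated over `k₀`, `⊆ O`, regular and clean at the centre.  Put `A' := k·A₀' = S⁻¹A₀'` (the `k`-subalgebra of `K`
generated by `A₀'`): `A' ⊆ O` (as `k ⊆ O`), `A ≤ A'`, `A'` is finitely generated over `k`, and again `locAtCentre A' O = locAtCentre A₀' O`,
so regularity and the clean representative (an identity in `K` between elements of that common local ring) carry over verbatim. ∎
CONSEQUENCE (memo §4): with `k₀ = 𝔽_p` (perfect) this puts the finitely-generated-`k` part of S2′ inside perfect-ground-field clean LU at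
the same LOCAL dimension (non-closed centres), and a `k`-CLOSED centre with `trdeg_{𝔽_p} k = e` is an `𝔽_p`-centre of height `n` on an
`(n+e)`-dimensional model.  [folklore] -/
def CleanLUTransferDown (p n : ℕ) : Prop :=
  ∀ (k₀ k : Type) [Field k₀] [Field k] [Algebra k₀ k], Algebra.EssFiniteType k₀ k →
    CleanLUAtDimOver p k₀ n → CleanLUAtDimOver p k n

/-- **The two-dimensional probe of the `dim 4` perfect frontier** (memo §4): clean LU for SURFACES over `k = 𝔽_p(s,t)`
(`[k : k^p] = p²`).  By `CleanLUTransferDown` it is implied by perfect-ground-field clean LU at local dimension 2 (centres with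
residue transcendence degree 2, i.e. height-2 centres of fourfolds over `𝔽_p`), hence — through composite valuations and the landed
generisation of `P_clean` — by closed-centre clean LU for FOURFOLDS over `𝔽_p`; a counterexample here refutes `CleanLUAtDim 4` over a
perfect field (and `CleanModelsDimGEFourPerfectAt p`, Giraud's conjecture 18001 in dim 4); a proof is a first rung of S2′'s family not in
print (Giraud 1983 Thm 2.4: `n_Ω = 2`, perfect residue fields only; Cossart 1987: dim 3 over algebraically closed `k` ⇒ `e ≤ 1`).
Status: OPEN (not attempted here beyond the specimens of §3).  [folklore] -/
def SurfaceProbeFpST (p : ℕ) [Fact p.Prime] : Prop :=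
  CleanLUAtDimOver p (FractionRing (MvPolynomial (Fin 2) (ZMod p))) 2

/-- Sanity: the probe field has characteristic `p` (instance search: `ZMod p → MvPolynomial → FractionRing`).  [folklore] -/
example (p : ℕ) [Fact p.Prime] : CharP (FractionRing (MvPolynomial (Fin 2) (ZMod p))) p := inferInstance

/-- Book-keeping: `CleanLUTransferDown p n` and clean LU over the prime field at local dimension `n` give clean LU at local dimension
`n` over every field essentially of finite type over `𝔽_p` — in particular the `k`-finitely-generated instances of
`CleanLUAtDimImperfectAt p n` (any `n`, so for `n ≥ 4` the f.g. part of S2′) and, for `n = 2`, `SurfaceProbeFpST p`.  [folklore] -/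
theorem cleanLUAtDimOver_of_prime_field (p n : ℕ) [Fact p.Prime] (hT : CleanLUTransferDown p n)
    (h0 : CleanLUAtDimOver p (ZMod p) n) (k : Type) [Field k] [Algebra (ZMod p) k] [Algebra.EssFiniteType (ZMod p) k] :
    CleanLUAtDimOver p k n :=
  hT (ZMod p) k ‹_› h0

/-- The surface probe is such an instance (`𝔽_p(s,t)` is essentially of finite type over `𝔽_p`).  [folklore] -/
theorem surfaceProbeFpST_of_prime_field (p : ℕ) [Fact p.Prime] (hT : CleanLUTransferDown p 2)
    (h0 : CleanLUAtDimOver p (ZMod p) 2) : SurfaceProbeFpST p :=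
  cleanLUAtDimOver_of_prime_field p 2 hT h0 _

end Summit.ResolutionOfSingularities.ResolutionOfSingularities.Cruxes.DescentPerfectToAll.NegationLens6g5

end
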